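import Mathlib
import Summits.ValiantsHypothesis.ValiantsHypothesis.Theorems.BinomialElusiveBinomialCandidateAffinePeeling

/-!
# Crux `BinomialElusive.BinomialCandidate` (stmt-ValiantsHypothesis-7392), line `registered` —
# helper for the stub `stub_polarPeeling`: a pole forces a common zero of the quadratic parts

The registered stub `stub_polarPeeling` (polar half of the sibling crux `PeelingLemma`,
stmt-ValiantsHypothesis-7391) concerns quadratic maps `Γ : ℂ^{m-1} → ℂ^m` together with a formal
LAURENT solution `p` of `Γ(p) = (t^{N a_i} + t^{N b_i})_i` having a genuine pole (`(p j).order < 0`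
for some `j`): the binomial curve is swallowed "from infinity".

This file lands the first step of peeling from the deepest pole, uniform in `m` and Mathlib-only
(plus the wave-1 helper `AffinePeeling.algebraMap_laurentSeries_apply`):

* `PolarPeeling.polar_forces_commonZero` — STRUCTURE.  Let `μ < 0` and suppose every coordinate
  `p j` has no coefficients below `μ` while the output `Γ(p)` (`totalDegree Γ ≤ 2`) has no
  coefficients at negative exponents.  Then the quadratic part `B = homogeneousComponent 2 Γ`
  vanishes at the pole-direction vector `z = ((p j).coeff μ)_j`.  Indeed the `t^{2μ}` coefficient of
  `Γ(p) = Σ_d c_d ∏_j (p j)^{d j}` only sees the monomials of degree `|d| = 2` (a monomial of degree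
  `|d| ≤ 1` has no coefficients below `|d| μ > 2μ`), where it equals `c_d ∏_j z_j^{d j}`
  (`coeff_prod_pow_eq`: lowest-order coefficients multiply); so `(Γ(p)).coeff (2μ) = B(z)`, and the
  left side is `0`.
* `PolarPeeling.polar_no_solution` — taking `μ` the least order among the `p j` (negative by the
  pole hypothesis) makes `z ≠ 0` (the minimiser contributes its leading coefficient), so the `m`
  quadratic parts `B_i` share the nontrivial zero `z ∈ ℂ^{m-1}`.  Hence GENERIC `Γ` — those whose
  quadratic parts have no common nontrivial zero, the complement of a resultant hypersurface since
  there are `m` forms in `m - 1` variables — admit no polar solution at all.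
* `polarPeeling_noCommonZero` — the registered stub's statement with the extra genericity
  hypothesis, for every `m ≥ 1` (vacuously: the hypotheses are contradictory).

Source of the line: Garg–Makam–Oliveira–Wigderson 2019 (arXiv:1904.04299) §9 (Lemma 9.3,
Prop. 9.8); the computation here is the initial-form (lowest-order) calculus of formal Laurent
series, folklore.  NOT here: the discriminant locus (quadratic parts WITH a common zero), which is
the open content of `stub_polarPeeling` (next step: in coordinates with `z = e₁` every `Γ_i` is
affine-linear in `y₁`).
-/

-- layout Summits/ValiantsHypothesis/ValiantsHypothesis forces the duplicated namespace component
set_option linter.dupNamespace false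

namespace Summit.ValiantsHypothesis.ValiantsHypothesis.Theorems.BinomialCandidateStubs

open scoped BigOperators

namespace PolarPeeling

/-! ## Lowest-order calculus: series with no coefficients below a given exponent -/

section LowestOrder

variable {R : Type*} [CommSemiring R]

/-- If `x` has no coefficients below `a` and `y` none below `b`, the coefficient of `x * y` at
`a + b` is `x.coeff a * y.coeff b` (only the pair `(a, b)` of the add-antidiagonal survives). -/
theorem coeff_mul_eq {x y : HahnSeries ℤ R} {a b : ℤ}
    (hx : ∀ g < a, x.coeff g = 0) (hy : ∀ g < b, y.coeff g = 0) :
    (x * y).coeff (a + b) = x.coeff a * y.coeff b := by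
  rw [HahnSeries.coeff_mul, Finset.sum_eq_single (a, b)]
  · rintro ⟨i, j⟩ hij hne
    obtain ⟨-, -, hsum⟩ := Finset.mem_antidiagonal.mp hij
    dsimp only at hsum ⊢
    rcases lt_trichotomy i a with h | rfl | h
    · rw [hx i h, zero_mul]
    · have hj : j = b := add_left_cancel hsum
      subst hj
      exact absurd rfl hne
    · rw [hy j (by omega), mul_zero]
  · intro hnot
    by_contra h
    obtain ⟨ha, hb⟩ := ne_zero_and_ne_zero_of_mul h
    exact hnot (Finset.mem_antidiagonal.mpr ⟨ha, hb, rfl⟩)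

/-- If `x` has no coefficients below `a` and `y` none below `b`, then `x * y` has none below
`a + b`. -/
theorem coeff_mul_eq_zero_of_lt {x y : HahnSeries ℤ R} {a b : ℤ}
    (hx : ∀ g < a, x.coeff g = 0) (hy : ∀ g < b, y.coeff g = 0) :
    ∀ g < a + b, (x * y).coeff g = 0 := by
  intro g hg
  rw [HahnSeries.coeff_mul]
  refine Finset.sum_eq_zero fun ij hij => ?_
  obtain ⟨-, -, hsum⟩ := Finset.mem_antidiagonal.mp hij
  rcases lt_or_ge ij.1 a with h | h
  · rw [hx _ h, zero_mul]
  · rw [hy _ (by omega), mul_zero]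

/-- Powers: if `x` has no coefficients below `a`, then `x ^ n` has none below `n a` and its
coefficient there is `(x.coeff a) ^ n`. -/
theorem coeff_pow_eq {x : HahnSeries ℤ R} {a : ℤ} (hx : ∀ g < a, x.coeff g = 0) (n : ℕ) :
    (∀ g < (n : ℤ) * a, (x ^ n).coeff g = 0) ∧ (x ^ n).coeff ((n : ℤ) * a) = x.coeff a ^ n := by
  induction n with
  | zero =>
    refine ⟨fun g hg => ?_, by simp⟩
    rw [pow_zero, HahnSeries.coeff_one, if_neg (by push_cast at hg; omega)]
  | succ n ih =>
    rw [pow_succ, pow_succ, Nat.cast_succ, add_mul, one_mul]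
    exact ⟨coeff_mul_eq_zero_of_lt ih.1 hx, by rw [coeff_mul_eq ih.1 hx, ih.2]⟩

/-- Finite products: if each `f i` (`i ∈ s`) has no coefficients below `a i`, then `∏ f i` has
none below `∑ a i` and its coefficient there is `∏ (f i).coeff (a i)`. -/
theorem coeff_prod_eq {ι : Type*} [DecidableEq ι] (s : Finset ι) (f : ι → HahnSeries ℤ R)
    (a : ι → ℤ) (hf : ∀ i ∈ s, ∀ g < a i, (f i).coeff g = 0) :
    (∀ g < ∑ i ∈ s, a i, (∏ i ∈ s, f i).coeff g = 0) ∧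
      (∏ i ∈ s, f i).coeff (∑ i ∈ s, a i) = ∏ i ∈ s, (f i).coeff (a i) := by
  induction s using Finset.induction_on with
  | empty =>
    refine ⟨fun g hg => ?_, by simp⟩
    rw [Finset.sum_empty] at hg
    rw [Finset.prod_empty, HahnSeries.coeff_one, if_neg hg.ne]
  | insert j s hj ih =>
    have hfj := hf j (Finset.mem_insert_self j s)
    have ih' := ih fun i hi => hf i (Finset.mem_insert_of_mem hi)
    rw [Finset.prod_insert hj, Finset.sum_insert hj, Finset.prod_insert hj]
    exact ⟨coeff_mul_eq_zero_of_lt hfj ih'.1, by rw [coeff_mul_eq hfj ih'.1, ih'.2]⟩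

/-- Monomials in `p`: if every `p j` has no coefficients below `μ`, then `∏_j (p j)^{d j}` has none
below `|d| μ` and its coefficient there is `∏_j ((p j).coeff μ)^{d j}`. -/
theorem coeff_prod_pow_eq {n : ℕ} (p : Fin n → HahnSeries ℤ R) (μ : ℤ)
    (hp : ∀ j, ∀ g < μ, (p j).coeff g = 0) (d : Fin n →₀ ℕ) :
    (∀ g < ((Finsupp.degree d : ℕ) : ℤ) * μ, (∏ j, p j ^ d j).coeff g = 0) ∧
      (∏ j, p j ^ d j).coeff (((Finsupp.degree d : ℕ) : ℤ) * μ) = ∏ j, (p j).coeff μ ^ d j := by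
  have h := coeff_prod_eq Finset.univ (fun j => p j ^ d j) (fun j => (d j : ℤ) * μ)
    fun j _ => (coeff_pow_eq (hp j) (d j)).1
  have hsum : ∑ j, (d j : ℤ) * μ = ((Finsupp.degree d : ℕ) : ℤ) * μ := by
    rw [← Finset.sum_mul, Finsupp.degree_eq_sum, Nat.cast_sum]
  rw [hsum] at h
  refine ⟨h.1, ?_⟩
  rw [h.2]
  exact Finset.prod_congr rfl fun j _ => (coeff_pow_eq (hp j) (d j)).2

/-- For `μ < 0` and `|d| ≤ 2`: the coefficient of `∏_j (p j)^{d j}` at `2μ` is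
`∏_j ((p j).coeff μ)^{d j}` if `|d| = 2` and `0` otherwise (then `|d| μ > 2 μ`). -/
theorem coeff_prod_pow_two_mul {n : ℕ} (p : Fin n → HahnSeries ℤ R) (μ : ℤ) (hμ : μ < 0)
    (hp : ∀ j, ∀ g < μ, (p j).coeff g = 0) (d : Fin n →₀ ℕ) (hd : Finsupp.degree d ≤ 2) :
    (∏ j, p j ^ d j).coeff (2 * μ) =
      if Finsupp.degree d = 2 then ∏ j, (p j).coeff μ ^ d j else 0 := by
  obtain ⟨h1, h2⟩ := coeff_prod_pow_eq p μ hp d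
  split_ifs with h
  · rw [← h2, h, Nat.cast_ofNat]
  · apply h1
    have : ((Finsupp.degree d : ℕ) : ℤ) < 2 := by exact_mod_cast lt_of_le_of_ne hd h
    nlinarith

end LowestOrder

/-! ## A pole forces a common zero of the quadratic parts -/

/-- The support of a polynomial of total degree `≤ 2` consists of exponents of degree `≤ 2`. -/
theorem degree_le_of_mem_support {n : ℕ} {Γ : MvPolynomial (Fin n) ℂ} (hΓ : Γ.totalDegree ≤ 2)
    {d : Fin n →₀ ℕ} (hd : d ∈ Γ.support) : Finsupp.degree d ≤ 2 :=
  (MvPolynomial.le_totalDegree hd).trans hΓ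

/-- **Structure lemma.**  If `μ < 0`, no `p j` has coefficients below `μ`, and the output
`Γ(p)` (`totalDegree Γ ≤ 2`) has no coefficients at negative exponents, then the quadratic part of
`Γ` vanishes at the pole-direction vector `z_j = (p j).coeff μ`:  the `t^{2μ}` coefficient of
`Γ(p)` is exactly `(homogeneousComponent 2 Γ)(z)`. -/
theorem polar_forces_commonZero {n : ℕ} (Γ : MvPolynomial (Fin n) ℂ) (hΓ : Γ.totalDegree ≤ 2)
    (p : Fin n → LaurentSeries ℂ) (μ : ℤ) (hμ : μ < 0) (hp : ∀ j, ∀ g < μ, (p j).coeff g = 0)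
    (hout : ∀ g < 0, (MvPolynomial.aeval p Γ).coeff g = 0) :
    MvPolynomial.eval (fun j => (p j).coeff μ) (MvPolynomial.homogeneousComponent 2 Γ) = 0 := by
  classical
  have key : (MvPolynomial.aeval p Γ).coeff (2 * μ) =
      MvPolynomial.eval (fun j => (p j).coeff μ) (MvPolynomial.homogeneousComponent 2 Γ) := by
    rw [MvPolynomial.aeval_def, MvPolynomial.eval₂_eq', HahnSeries.coeff_sum,
      MvPolynomial.homogeneousComponent_apply, map_sum, Finset.sum_filter]
    refine Finset.sum_congr rfl fun d hd => ?_
    rw [AffinePeeling.algebraMap_laurentSeries_apply, HahnSeries.coeff_single_zero_mul,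
      coeff_prod_pow_two_mul p μ hμ hp d (degree_le_of_mem_support hΓ hd),
      MvPolynomial.eval_monomial, Finsupp.prod_pow]
    split_ifs <;> simp
  rw [← key]
  exact hout _ (by omega)

/-- The binomial outputs `t^{N a} + t^{N b}` have no coefficients at negative exponents. -/
theorem coeff_binomial_eq_zero_of_neg (N a b : ℕ) (g : ℤ) (hg : g < 0) :
    (HahnSeries.single ((N * a : ℕ) : ℤ) (1 : ℂ) +
      HahnSeries.single ((N * b : ℕ) : ℤ) (1 : ℂ)).coeff g = 0 := by
  rw [HahnSeries.coeff_add, HahnSeries.coeff_single_of_ne (by omega),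
    HahnSeries.coeff_single_of_ne (by omega), add_zero]

/-- **Generic `Γ` admit no polar solution.**  If some `p j` has a pole, every output `Γ_i(p)`
(`totalDegree ≤ 2`) has no coefficients at negative exponents, and the quadratic parts
`homogeneousComponent 2 (Γ i)` have no common nontrivial zero, we reach a contradiction: with `μ`
the least order among the `p j` and `z_j = (p j).coeff μ`, `z ≠ 0` is a common zero
(`polar_forces_commonZero`). -/
theorem polar_no_solution {m n : ℕ} (Γ : Fin m → MvPolynomial (Fin n) ℂ)
    (hΓ : ∀ i, (Γ i).totalDegree ≤ 2) (p : Fin n → LaurentSeries ℂ) (hpole : ∃ j, (p j).order < 0)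
    (hgen : ∀ z : Fin n → ℂ, z ≠ 0 →
      ∃ i, MvPolynomial.eval z (MvPolynomial.homogeneousComponent 2 (Γ i)) ≠ 0)
    (hout : ∀ i, ∀ g < 0, (MvPolynomial.aeval p (Γ i)).coeff g = 0) : False := by
  obtain ⟨j₀, hj₀⟩ := hpole
  obtain ⟨j₁, -, hj₁⟩ :=
    Finset.exists_min_image Finset.univ (fun j => (p j).order) ⟨j₀, Finset.mem_univ _⟩
  have hμ : (p j₁).order < 0 := lt_of_le_of_lt (hj₁ j₀ (Finset.mem_univ _)) hj₀
  have hp : ∀ j, ∀ g < (p j₁).order, (p j).coeff g = 0 := fun j g hg =>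
    HahnSeries.coeff_eq_zero_of_lt_order (lt_of_lt_of_le hg (hj₁ j (Finset.mem_univ _)))
  have hz : (fun j => (p j).coeff (p j₁).order) ≠ 0 := by
    intro h
    have h1 : p j₁ = 0 := HahnSeries.coeff_order_eq_zero.mp (congr_fun h j₁)
    rw [h1, HahnSeries.order_zero] at hμ
    exact lt_irrefl _ hμ
  obtain ⟨i, hi⟩ := hgen _ hz
  exact hi (polar_forces_commonZero (Γ i) (hΓ i) p _ hμ hp (hout i))

end PolarPeeling

/-- **`stub_polarPeeling`, generic corner** (every `m ≥ 1`): the registered stub's statement with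
the extra hypothesis that the quadratic parts `homogeneousComponent 2 (Γ i)` have no common
nontrivial zero in `ℂ^{m-1}`.  It holds vacuously: a polar solution forces a common nontrivial zero
(`PolarPeeling.polar_no_solution`), the outputs `t^{N a_i} + t^{N b_i}` having no coefficients at
negative exponents. -/
theorem polarPeeling_noCommonZero :
    ∀ m ≥ 1, ∀ (a b : Fin m → ℕ) (Γ : Fin m → MvPolynomial (Fin (m - 1)) ℂ) (N : ℕ)
      (p : Fin (m - 1) → LaurentSeries ℂ), (∀ i, (Γ i).totalDegree ≤ 2) → 0 < N →
      (∃ j, (p j).order < 0) →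
      (∀ z : Fin (m - 1) → ℂ, z ≠ 0 → ∃ i, MvPolynomial.eval z (MvPolynomial.homogeneousComponent 2 (Γ i)) ≠ 0) →
      (∀ i, MvPolynomial.aeval p (Γ i) =
        HahnSeries.single ((N * a i : ℕ) : ℤ) (1 : ℂ) + HahnSeries.single ((N * b i : ℕ) : ℤ) (1 : ℂ)) →
      ∃ u v : Fin m → ℤ, (u, v) ≠ 0 ∧ ∑ i, (|u i| + |v i|) ≤ ((Nat.log 2 m ^ 2 : ℕ) : ℤ) ∧
        ∑ i, (u i * (a i : ℤ) + v i * (b i : ℤ)) = 0 := by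
  intro m _ a b Γ N p hΓ _ hpole hgen hp
  refine (PolarPeeling.polar_no_solution Γ hΓ p hpole hgen fun i g hg => ?_).elim
  rw [hp i]
  exact PolarPeeling.coeff_binomial_eq_zero_of_neg N (a i) (b i) g hg

end Summit.ValiantsHypothesis.ValiantsHypothesis.Theorems.BinomialCandidateStubs
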